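import Summits.HodgeConjecture.HodgeConjecture.Theorems.Ring2WeilCoverageCyclotomicTwistedLevel56Yes
import Summits.HodgeConjecture.HodgeConjecture.Theorems.Ring2WeilCoverageCyclotomicUnitGeomSums
import Summits.HodgeConjecture.HodgeConjecture.Theorems.Ring2WeilCoverageResidueDictionary
import HarnessLib

/-!
# Weil-type family coverage — the census level `M = 39`, YES direction: the twisted unit supply of `ℚ(ζ₃₉)⁺` needs
# the units of the subfield `ℚ(ζ₁₃)⁺` — a TWO-LEVEL family of geometric-sum units (`ζ₃₉` and `η = ζ₃₉³`), twenty
# `decide`d witnesses, and «`n₊₋(Φ)` ODD ⇒ principally polarisable» at `(39, ℚ(√−3))`, `(39, ℚ(√−39))`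

research route conditional on HC_CM; not a corollary; Q11.4-sentence-2 already refuted in dim ≥ 3.

Ring 2, WEIL-TYPE FAMILY-COVERAGE CENSUS (`HOME/WEIL-FAMILY-COVERAGE.md` `## b01`, block b01.25 (A): «`M = 39`: `A_Φ`
principal ⟺ `n₊₋(Φ)` ODD, both `K`»; b01.36 (E)/b01.38 (E): «the product family has sign rank 9 of the needed 10 at
39 — extra units wanted»; owner ring2-b01), part 40 of the `Ring2WeilCoverage*` series — the YES half at `39` (part
36 did the NO half).  The units `ζ^h(1−ζ^a)(1−ζ^b)` of part 13 and the geometric-sum units `ζ^c(1+ζ+⋯+ζ^{a−1})` of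
part 20 at level `39` both have sign rank `9`; the missing dimension is supplied by the cyclotomic units of
`ℚ(ζ₁₃)⁺ ⊂ ℚ(ζ₃₉)⁺`, i.e. part 20's family for the primitive 13th root `η = ζ³`.  So the family here is indexed by
`Bool × ℕ × ℕ`: `(false, a, c) ↦ ζ^c(1+ζ+⋯+ζ^{a−1})` (sign at `t`: `39 < at mod 78`), `(true, a, c) ↦
η^c(1+η+⋯+η^{a−1})` (sign at `t`: `13 < a·(t mod 13) mod 26`):

* §1 **`familyProperty_thirtyNine`** — the two-level family satisfies part 21's family property (the signed product
  splits as the level-39 part times the level-13 part; both are real units by part 20; signs multiply).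
* §2 `witnessTable_thirtyNine_plus/_minus` (`decide +kernel`, 20 witnesses, `g59/py/witness39g.py`),
  `pairProperty_thirtyNine`.
* §3 **`exists_principal_thirtyNine_of_even_on`**: `|S_Φ ∩ N_odd ∩ C₊|`, `|S_Φ ∩ N_odd ∩ C₋|` BOTH EVEN ⇒
  `ℂ^Φ/Φ(ℤ[ζ₃₉])` CARRIES an `ι`-compatible principal polarisation (`C₊ = {χ₁₃ = +1}`) — with part 36, principal
  polarisability of `ℂ^Φ/Φ(ℤ[ζ₃₉])` is DECIDED for all `2¹²` CM types, hypothesis-free.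
* §4 **`exists_principal_thirtyNine_sqrt_neg_three` / `…_sqrt_neg_thirtyNine`**: for `K`-balanced `Φ`,
  `n₊₋(Φ) = |S_Φ ∩ {14,17,23,29,35,38}|` ODD ⇒ YES — b01.25 (A)'s 472 + 472 YES classes at `39`, kernel, no PARI.

HONEST FRAMING: statements about Shimura's divisors of principal type on `ℂ^Φ/Φ(ℤ[ζ₃₉])` (principal lattice;
`h(ℚ(ζ₃₉)) = 2`); nothing about Hodge classes, `W_K`, general members or HC; `HC_CM` is used nowhere.  No `def`, no
named fact, no `sorry`.  References: [cite: Shimura1998, §14.3 Prop. 4–5, pp. 103–104]; [cite: Washington1997, §8.1,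
Lemma 8.1]; census b01.25 (A) (seat-derived).
-/

noncomputable section

open Polynomial NumberField Complex Finset
open scoped Real nonZeroDivisors

namespace Summit.HodgeConjecture.Ring2WeilCoverage.CyclotomicTwistedLevel39Yes

open Literature.AlgebraicGeometry.Motives (CMType)
open Literature.AlgebraicGeometry.HodgeTheory (IsCMTypeSet)
open Literature.AlgebraicGeometry.ComplexMultiplication.CyclotomicCMType (isCMTypeSet_residueFilter)
open Literature.NumberTheory.ComplexMultiplication
open Summit.HodgeConjecture.Ring2WeilCoverage.TwistedUnitWitnesses
open Summit.HodgeConjecture.Ring2WeilCoverage.CyclotomicTwistedObstruction (card_inter_mod_two_eq_on)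
open Summit.HodgeConjecture.Ring2WeilCoverage.CyclotomicTwistedLevel56Yes (row_parities)
open Summit.HodgeConjecture.Ring2WeilCoverage.CyclotomicUnitGeomSums
  (exists_units_coe_eq_geomSum re_embedding_prod_geomSum_neg_iff)
open Summit.HodgeConjecture.Ring2WeilCoverage.ResidueDictionary (toCircle_pow_div_mul isUnit_cast_of_coprime)
open Summit.HodgeConjecture.Ring2WeilCoverage.CMTypeSetOddPositions (two_mul_card_eq_card_units)
open Literature.NumberTheory.ComplexMultiplication.CMTypeLattice (im_embedding_eq_zero_of_complexConj_eq)

variable {K : Type} [Field K] [NumberField K] {ζ : K}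

/-- `𝐞(t) = exp(2πi t/n) ∈ ℂ` (`ZMod.toCircle`, any level). -/
local notation3 (prettyPrint := false) "𝐞 " t:max => ((ZMod.toCircle t : Circle) : ℂ)

/-- the sign law of the two-level family at the unit residue `t` mod `39`. -/
local notation3 (prettyPrint := false) "sgn" =>
  (fun (x : Bool × ℕ × ℕ) (t : ZMod 39) =>
    if x.1 then 13 < x.2.1 * ZMod.val (((ZMod.val t * 1 : ℕ)) : ZMod 13) % (2 * 13)
    else 39 < x.2.1 * ZMod.val t % (2 * 39))

/-- admissibility (part 20's, at level `13` resp. `39`). -/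
local notation3 (prettyPrint := false) "adm" =>
  (fun x : Bool × ℕ × ℕ =>
    if x.1 then (Nat.Coprime x.2.1 13 ∧ (2 * x.2.2 + x.2.1 - 1) % (2 * 13) = 0 ∧ 1 ≤ x.2.1)
    else (Nat.Coprime x.2.1 39 ∧ (2 * x.2.2 + x.2.1 - 1) % (2 * 39) = 0 ∧ 1 ≤ x.2.1))

/-- the sign pattern of the signed product `(A, ε)` at `t`. -/
local notation3 (prettyPrint := false) "pat " A:max ε:max t:max =>
  Odd ((Finset.filter (fun x : Bool × ℕ × ℕ => sgn x t) A).card + (if (ε : Bool) then 1 else 0))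

/-- The census's set `N_odd` at `39`, as a filter. -/
local notation3 (prettyPrint := false) "Nodd" =>
  (Finset.univ.filter fun t : ZMod 39 => t.val.Coprime 39 ∧
    Even (Finset.card (Finset.filter (fun s : ZMod 39 => s.val.Coprime 39 ∧ s.val < t.val) Finset.univ)))

/-- the class `C₊ = {t : χ₁₃(t) = +1}` of unit residues mod `39`. -/
local notation3 (prettyPrint := false) "Cp" => ({1, 4, 10, 14, 16, 17, 22, 23, 25, 29, 35, 38} : Finset (ZMod 39))

/-- the class `C₋ = {t : χ₁₃(t) = −1}` of unit residues mod `39`. -/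
local notation3 (prettyPrint := false) "Cm" => ({2, 5, 7, 8, 11, 19, 20, 28, 31, 32, 34, 37} : Finset (ZMod 39))

/-! ### §1 The two-level geometric-sum family -/

/-- A product of two non-zero reals is negative iff exactly one factor is. [folklore] -/
theorem mul_neg_iff_xor {a b : ℝ} (ha : a ≠ 0) (hb : b ≠ 0) : a * b < 0 ↔ (a < 0 ↔ ¬ b < 0) := by
  rcases lt_or_gt_of_ne ha with h1 | h1 <;> rcases lt_or_gt_of_ne hb with h2 | h2
  · exact ⟨fun h => absurd (mul_pos_of_neg_of_neg h1 h2) (lt_asymm h), fun h => absurd h2 (h.mp h1)⟩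
  · exact ⟨fun _ => ⟨fun _ => lt_asymm h2, fun _ => h1⟩, fun _ => mul_neg_of_neg_of_pos h1 h2⟩
  · exact ⟨fun _ => ⟨fun h => absurd h1 (lt_asymm h), fun h => absurd h2 h⟩, fun _ => mul_neg_of_pos_of_neg h1 h2⟩
  · exact ⟨fun h => absurd (mul_pos h1 h2) (lt_asymm h), fun h => absurd (h.mpr (lt_asymm h2)) (lt_asymm h1)⟩

/-- **The family property of part 21 for the two-level family at `39`**: an admissible signed product `(A, ε)` is a
unit of `𝓞 K` fixed by `ρ` whose sign at the place reading `t` is `pat A ε t` (the level-39 part and the level-13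
part are part 20's units for `ζ` and `η = ζ³`; `φ(η) = 𝐞₁₃(t mod 13)`).
research route conditional on HC_CM; not a corollary; Q11.4-sentence-2 already refuted in dim ≥ 3. [cite: Washington1997, §8.1, Lemma 8.1] -/
theorem familyProperty_thirtyNine [IsCMField K] (hζ : IsPrimitiveRoot ζ 39) :
    ∀ A : Finset (Bool × ℕ × ℕ), (∀ x ∈ A, adm x) → ∀ ε : Bool,
      ∃ u : (𝓞 K)ˣ, IsCMField.complexConj K ((u : 𝓞 K) : K) = ((u : 𝓞 K) : K) ∧
        ∀ (φ : K →+* ℂ) (t : ZMod 39), φ ζ = 𝐞 t → t.val.Coprime 39 →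
          (((φ ((u : 𝓞 K) : K)).re < 0) ↔ pat A ε t) := by
  classical
  intro A hA ε
  have hη : IsPrimitiveRoot (ζ ^ 3) 13 := hζ.pow (by norm_num) (by norm_num)
  set A₀ : Finset (ℕ × ℕ) := (A.filter fun x => x.1 = false).image Prod.snd with hA₀
  set A₁ : Finset (ℕ × ℕ) := (A.filter fun x => x.1 = true).image Prod.snd with hA₁
  have hinj : ∀ b : Bool, Set.InjOn (Prod.snd : Bool × ℕ × ℕ → ℕ × ℕ) ↑(A.filter fun x => x.1 = b) := by
    intro b x hx y hy h
    have hx1 := (Finset.mem_filter.mp (Finset.mem_coe.mp hx)).2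
    have hy1 := (Finset.mem_filter.mp (Finset.mem_coe.mp hy)).2
    exact Prod.ext (hx1.trans hy1.symm) h
  have hA₀adm : ∀ y ∈ A₀, Nat.Coprime y.1 39 ∧ (2 * y.2 + y.1 - 1) % (2 * 39) = 0 ∧ 1 ≤ y.1 := by
    intro y hy
    obtain ⟨x, hx, rfl⟩ := Finset.mem_image.mp hy
    obtain ⟨hxA, hx1⟩ := Finset.mem_filter.mp hx
    have h := hA x hxA
    simp only [hx1, Bool.false_eq_true, ↓reduceIte] at h
    exact h
  have hA₁adm : ∀ y ∈ A₁, Nat.Coprime y.1 13 ∧ (2 * y.2 + y.1 - 1) % (2 * 13) = 0 ∧ 1 ≤ y.1 := by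
    intro y hy
    obtain ⟨x, hx, rfl⟩ := Finset.mem_image.mp hy
    obtain ⟨hxA, hx1⟩ := Finset.mem_filter.mp hx
    have h := hA x hxA
    simp only [hx1, ↓reduceIte] at h
    exact h
  obtain ⟨u₀, hu₀, hc₀⟩ := exists_units_coe_eq_geomSum (by norm_num : 2 ≤ 39) hζ hA₀adm ε
  obtain ⟨u₁, hu₁, hc₁⟩ := exists_units_coe_eq_geomSum (by norm_num : 2 ≤ 13) hη hA₁adm false
  refine ⟨u₀ * u₁, ?_, fun φ t hφ ht => ?_⟩
  · push_cast
    rw [map_mul, hc₀, hc₁]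
  · -- the embedding at level 13
    have hφη : φ (ζ ^ 3) = 𝐞 (((t.val * 1 : ℕ)) : ZMod 13) := by
      rw [map_pow, hφ, show (3 : ℕ) = 39 / 13 * 1 by norm_num]
      exact toCircle_pow_div_mul (by norm_num : 13 ∣ 39) t 1
    have ht' : (((t.val * 1 : ℕ)) : ZMod 13).val.Coprime 13 := by
      obtain ⟨w, hw⟩ := isUnit_cast_of_coprime (n := 39) (f := 13) (by norm_num) ht
      have := ZMod.val_coe_unit_coprime w
      rw [hw, ← mul_one t.val] at this
      exact_mod_cast this
    have h₀ := re_embedding_prod_geomSum_neg_iff (by norm_num : 2 ≤ 39) hφ ht A₀ hA₀adm ε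
    have h₁ := re_embedding_prod_geomSum_neg_iff (by norm_num : 2 ≤ 13) hφη ht' A₁ hA₁adm false
    rw [← hu₀] at h₀
    rw [← hu₁] at h₁
    -- both factors are real
    have him₀ := im_embedding_eq_zero_of_complexConj_eq hc₀ φ
    have him₁ := im_embedding_eq_zero_of_complexConj_eq hc₁ φ
    have hre : (φ (((u₀ * u₁ : (𝓞 K)ˣ) : 𝓞 K) : K)).re =
        (φ ((u₀ : 𝓞 K) : K)).re * (φ ((u₁ : 𝓞 K) : K)).re := by
      push_cast
      rw [map_mul, Complex.mul_re, him₀, him₁, mul_zero, sub_zero]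
    rw [hre, mul_neg_iff_xor h₀.2 h₁.2, h₀.1, h₁.1]
    -- count: the pattern of `A` splits along the flag
    have hc0 : (A₀.filter fun y : ℕ × ℕ => 39 < y.1 * t.val % (2 * 39)).card =
        ((A.filter fun x => x.1 = false).filter fun x => sgn x t).card := by
      rw [hA₀, Finset.filter_image, Finset.card_image_of_injOn ((hinj false).mono (by
        intro x hx; exact Finset.mem_coe.mpr (Finset.mem_of_mem_filter x (Finset.mem_coe.mp hx))))]
      congr 1
      apply Finset.filter_congr
      intro x hx
      have hx1 := (Finset.mem_filter.mp hx).2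
      simp only [hx1, Bool.false_eq_true, ↓reduceIte]
    have hc1 : (A₁.filter fun y : ℕ × ℕ => 13 < y.1 * (((t.val * 1 : ℕ)) : ZMod 13).val % (2 * 13)).card =
        ((A.filter fun x => x.1 = true).filter fun x => sgn x t).card := by
      rw [hA₁, Finset.filter_image, Finset.card_image_of_injOn ((hinj true).mono (by
        intro x hx; exact Finset.mem_coe.mpr (Finset.mem_of_mem_filter x (Finset.mem_coe.mp hx))))]
      congr 1
      apply Finset.filter_congr
      intro x hx
      have hx1 := (Finset.mem_filter.mp hx).2
      simp only [hx1, ↓reduceIte]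
    have hsplit : (A.filter fun x => sgn x t).card =
        ((A.filter fun x => x.1 = false).filter fun x => sgn x t).card +
          ((A.filter fun x => x.1 = true).filter fun x => sgn x t).card := by
      rw [Finset.filter_filter, Finset.filter_filter, ← Finset.card_union_of_disjoint]
      · congr 1
        ext x
        simp only [Finset.mem_filter, Finset.mem_union]
        cases x.1 <;> simp
      · exact Finset.disjoint_filter.mpr fun x _ h1 h2 => by rw [h1.1] at h2; exact Bool.false_ne_true h2.1
    rw [hc0] at *
    rw [hc1, hsplit]
    simp only [Bool.false_eq_true, ↓reduceIte, add_zero]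
    rcases Nat.even_or_odd ((A.filter fun x => x.1 = false).filter fun x => sgn x t).card with e0 | e0 <;>
    rcases Nat.even_or_odd ((A.filter fun x => x.1 = true).filter fun x => sgn x t).card with e1 | e1 <;>
    cases ε <;>
    simp only [Bool.false_eq_true, ↓reduceIte, add_zero, Nat.odd_add_one, Nat.odd_add, Nat.not_odd_iff_even,
      e0, e1, iff_true, iff_false, not_true, not_false_eq_true, Nat.not_even_iff_odd.mpr]

/-! ### §2 The twenty witnesses (`g59/py/witness39g.py`) -/

/-- **Witness table, class `C₊` (base `1`)** (`decide`): for every unit residue `s ∈ C₊`, `s ≠ ±1`, the listed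
signed product of the two-level family is negative exactly at `{±1, ±s}`.
research route conditional on HC_CM; not a corollary; Q11.4-sentence-2 already refuted in dim ≥ 3. [folklore] -/
theorem witnessTable_thirtyNine_plus :
    ∀ s ∈ (Finset.univ.filter fun s : ZMod 39 => s.val.Coprime 39 ∧ s ∈ Cp ∧ s ≠ 1 ∧ s ≠ -1),
      ∃ w ∈ ({
    (4, {(false, 5, 37), (false, 7, 36), (true, 3, 12), (true, 7, 10)}, true),
    (10, {(false, 7, 36), (false, 11, 34), (true, 7, 10)}, true),
    (14, {(false, 17, 31), (false, 35, 22), (true, 5, 11)}, true),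
    (16, {(false, 7, 36), (false, 11, 34), (false, 17, 31), (false, 35, 22)}, true),
    (17, {(false, 5, 37), (false, 19, 30), (false, 25, 27)}, true),
    (22, {(false, 5, 37), (false, 19, 30), (false, 25, 27)}, true),
    (23, {(false, 7, 36), (false, 11, 34), (false, 17, 31), (false, 35, 22)}, true),
    (25, {(false, 17, 31), (false, 35, 22), (true, 5, 11)}, true),
    (29, {(false, 7, 36), (false, 11, 34), (true, 7, 10)}, true),
    (35, {(false, 5, 37), (false, 7, 36), (true, 3, 12), (true, 7, 10)}, true)} :
      Finset (ZMod 39 × Finset (Bool × ℕ × ℕ) × Bool)),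
        w.1 = s ∧ (∀ x ∈ w.2.1, adm x) ∧
          ∀ t ∈ (Finset.univ.filter fun t : ZMod 39 => t.val.Coprime 39),
            (pat w.2.1 w.2.2 t ↔ (t = 1 ∨ t = -1 ∨ t = s ∨ t = -s)) := by
  decide +kernel

/-- **Witness table, class `C₋` (base `2`)** (`decide`): for every unit residue `s ∈ C₋`, `s ≠ ±2`, the listed signed
product of the two-level family is negative exactly at `{±2, ±s}`.
research route conditional on HC_CM; not a corollary; Q11.4-sentence-2 already refuted in dim ≥ 3. [folklore] -/
theorem witnessTable_thirtyNine_minus :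
    ∀ s ∈ (Finset.univ.filter fun s : ZMod 39 => s.val.Coprime 39 ∧ s ∈ Cm ∧ s ≠ 2 ∧ s ≠ -2),
      ∃ w ∈ ({
    (5, {(false, 5, 37), (false, 19, 30), (false, 37, 21), (true, 3, 12)}, false),
    (7, {(false, 11, 34), (false, 23, 28), (false, 25, 27), (false, 37, 21)}, false),
    (8, {(false, 17, 31), (false, 29, 25), (true, 5, 11)}, false),
    (11, {(false, 5, 37), (false, 25, 27), (false, 31, 24), (true, 11, 8)}, false),
    (19, {(false, 25, 27), (false, 29, 25), (true, 7, 10)}, false),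
    (20, {(false, 25, 27), (false, 29, 25), (true, 7, 10)}, false),
    (28, {(false, 5, 37), (false, 25, 27), (false, 31, 24), (true, 11, 8)}, false),
    (31, {(false, 17, 31), (false, 29, 25), (true, 5, 11)}, false),
    (32, {(false, 11, 34), (false, 23, 28), (false, 25, 27), (false, 37, 21)}, false),
    (34, {(false, 5, 37), (false, 19, 30), (false, 37, 21), (true, 3, 12)}, false)} :
      Finset (ZMod 39 × Finset (Bool × ℕ × ℕ) × Bool)),
        w.1 = s ∧ (∀ x ∈ w.2.1, adm x) ∧
          ∀ t ∈ (Finset.univ.filter fun t : ZMod 39 => t.val.Coprime 39),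
            (pat w.2.1 w.2.2 t ↔ (t = 2 ∨ t = -2 ∨ t = s ∨ t = -s)) := by
  decide +kernel

/-- Class facts at `39` (`decide`). [folklore] -/
theorem classFacts_thirtyNine :
    (∀ t : ZMod 39, t.val.Coprime 39 → (t ∉ Cp ↔ t ∈ Cm)) ∧
    (∀ t : ZMod 39, t.val.Coprime 39 → (-t ∈ Cp ↔ t ∈ Cp)) ∧
    (∀ t ∈ Cm, -t ∈ Cm) ∧ (∀ t ∈ Cp, -t ∈ Cp) ∧ (1 : ZMod 39) ∈ Cp ∧ (2 : ZMod 39) ∉ Cp := by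
  refine ⟨by decide, by decide, by decide, by decide, by decide, by decide⟩

/-- **The same-class pair property at `39`** for the two-level family and the class `C₊`.
research route conditional on HC_CM; not a corollary; Q11.4-sentence-2 already refuted in dim ≥ 3. [folklore] -/
theorem pairProperty_thirtyNine :
    ∀ t₁ t₂ : ZMod 39, t₁.val.Coprime 39 → t₂.val.Coprime 39 → (t₁ ∈ Cp ↔ t₂ ∈ Cp) → t₂ ≠ t₁ → t₂ ≠ -t₁ →
      ∃ A : Finset (Bool × ℕ × ℕ), ∃ ε : Bool, (∀ x ∈ A, adm x) ∧
        ∀ t : ZMod 39, t.val.Coprime 39 → (pat A ε t ↔ (t = t₁ ∨ t = -t₁ ∨ t = t₂ ∨ t = -t₂)) := by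
  obtain ⟨hcompl, hCsym, -, -, h1, h2⟩ := classFacts_thirtyNine
  intro t₁ t₂ h₁ h₂ hcls hne hne'
  by_cases hc : t₁ ∈ Cp
  · refine pairs_on_of_base sgn adm Cp (b := 1) hCsym ?_ h₁ h₂ (by simp [hc, h1]) (by simp [hcls.mp hc, h1])
      hne hne'
    intro s hs hsc hs1 hs2
    have hsC : s ∈ Cp := by simpa [h1] using hsc
    obtain ⟨w, -, rfl, hA, hP⟩ :=
      witnessTable_thirtyNine_plus s (Finset.mem_filter.mpr ⟨Finset.mem_univ _, hs, hsC, hs1, hs2⟩)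
    exact ⟨w.2.1, w.2.2, hA, fun t ht => hP t (Finset.mem_filter.mpr ⟨Finset.mem_univ _, ht⟩)⟩
  · have hc₂ : t₂ ∉ Cp := fun h => hc (hcls.mpr h)
    refine pairs_on_of_base sgn adm Cp (b := 2) hCsym ?_ h₁ h₂ (by simp [hc, h2]) (by simp [hc₂, h2]) hne hne'
    intro s hs hsc hs1 hs2
    have hsC : s ∈ Cm := (hcompl s hs).mp (by simpa [h2] using hsc)
    obtain ⟨w, -, rfl, hA, hP⟩ :=
      witnessTable_thirtyNine_minus s (Finset.mem_filter.mpr ⟨Finset.mem_univ _, hs, hsC, hs1, hs2⟩)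
    exact ⟨w.2.1, w.2.2, hA, fun t ht => hP t (Finset.mem_filter.mpr ⟨Finset.mem_univ _, ht⟩)⟩

/-! ### §3 The YES verdict at `39` from the two twisted parities -/

open scoped Classical in
/-- **THE TWISTED YES VERDICT AT `M = 39`.**  For any `K` with `IsCyclotomicExtension {39} ℚ K`, `[IsCMField K]`,
`ζ` a primitive 39th root and ANY CM type `Φ`: if `|S_Φ ∩ N_odd ∩ C₊|` and `|S_Φ ∩ N_odd ∩ C₋|` are BOTH EVEN
(`C₊ = {χ₁₃ = +1}`), then `ℂ^Φ/Φ(ℤ[ζ₃₉])` CARRIES an `ι`-compatible principal polarisation.  With part 36 the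
principal polarisability of `ℂ^Φ/Φ(ℤ[ζ₃₉])` is DECIDED for all `2¹²` CM types, hypothesis-free.
research route conditional on HC_CM; not a corollary; Q11.4-sentence-2 already refuted in dim ≥ 3. [cite: Shimura1998, §14.3 Prop. 5, p. 104] -/
theorem exists_principal_thirtyNine_of_even_on [IsCMField K] [IsCyclotomicExtension {39} ℚ K]
    (hζ : IsPrimitiveRoot ζ 39) (Φ : CMType K)
    (hevC : Even (((Finset.univ.filter fun t : ZMod 39 => ∃ σ ∈ Φ.1, σ ζ = 𝐞 t) ∩ Nodd).filter
      fun t => t ∈ Cp).card)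
    (hevC' : Even (((Finset.univ.filter fun t : ZMod 39 => ∃ σ ∈ Φ.1, σ ζ = 𝐞 t) ∩ Nodd).filter
      fun t => t ∉ Cp).card) :
    ∃ ζ' : K, IsCMField.complexConj K ζ' = -ζ' ∧ (∀ φ : Φ.1, 0 < (φ.1 ζ').im) ∧
        CMTypeLattice.IsOfType (1 : (FractionalIdeal (𝓞 K)⁰ K)ˣ) ζ' ⊤ := by
  have hg : Nat.totient 39 = 2 * (11 + 1) := by decide
  exact exists_principal_of_pairs_on sgn adm Cp hζ hg (familyProperty_thirtyNine hζ) pairProperty_thirtyNine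
    classFacts_thirtyNine.2.1 Φ hevC hevC'

/-! ### §4 The census rows: `n₊₋(Φ)` ODD ⇒ principal, `K = ℚ(√−3)` and `K = ℚ(√−39)` -/

/-- Row data at `39` (`decide`): `N_odd`; `N_K` for `K = ℚ(√−3)` (`{t ≡ 2 (3)}`) and `K = ℚ(√−39)`; `E± = C± ∩ N_K`;
the constants `|C± ∩ (N_odd ∖ N_K)|` (`3, 5` resp. `3, 1`); `|units| = 24`. [folklore] -/
theorem rowData_thirtyNine :
    IsCMTypeSet 39 Nodd ∧
    (IsCMTypeSet 39 ({2, 5, 8, 11, 14, 17, 20, 23, 29, 32, 35, 38} : Finset (ZMod 39)) ∧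
      Cp ∩ ({2, 5, 8, 11, 14, 17, 20, 23, 29, 32, 35, 38} : Finset (ZMod 39)) = {14, 17, 23, 29, 35, 38} ∧
      Cm ∩ ({2, 5, 8, 11, 14, 17, 20, 23, 29, 32, 35, 38} : Finset (ZMod 39)) = {2, 5, 8, 11, 20, 32} ∧
      ({14, 17, 23, 29, 35, 38} : Finset (ZMod 39)) ∪ {2, 5, 8, 11, 20, 32} =
        ({2, 5, 8, 11, 14, 17, 20, 23, 29, 32, 35, 38} : Finset (ZMod 39)) ∧
      Disjoint ({14, 17, 23, 29, 35, 38} : Finset (ZMod 39)) {2, 5, 8, 11, 20, 32} ∧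
      (Cp ∩ (Nodd \ ({2, 5, 8, 11, 14, 17, 20, 23, 29, 32, 35, 38} : Finset (ZMod 39)))).card = 3 ∧
      (Cm ∩ (Nodd \ ({2, 5, 8, 11, 14, 17, 20, 23, 29, 32, 35, 38} : Finset (ZMod 39)))).card = 5) ∧
    (IsCMTypeSet 39 ({7, 14, 17, 19, 23, 28, 29, 31, 34, 35, 37, 38} : Finset (ZMod 39)) ∧
      Cp ∩ ({7, 14, 17, 19, 23, 28, 29, 31, 34, 35, 37, 38} : Finset (ZMod 39)) = {14, 17, 23, 29, 35, 38} ∧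
      Cm ∩ ({7, 14, 17, 19, 23, 28, 29, 31, 34, 35, 37, 38} : Finset (ZMod 39)) = {7, 19, 28, 31, 34, 37} ∧
      ({14, 17, 23, 29, 35, 38} : Finset (ZMod 39)) ∪ {7, 19, 28, 31, 34, 37} =
        ({7, 14, 17, 19, 23, 28, 29, 31, 34, 35, 37, 38} : Finset (ZMod 39)) ∧
      Disjoint ({14, 17, 23, 29, 35, 38} : Finset (ZMod 39)) {7, 19, 28, 31, 34, 37} ∧
      (Cp ∩ (Nodd \ ({7, 14, 17, 19, 23, 28, 29, 31, 34, 35, 37, 38} : Finset (ZMod 39)))).card = 3 ∧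
      (Cm ∩ (Nodd \ ({7, 14, 17, 19, 23, 28, 29, 31, 34, 35, 37, 38} : Finset (ZMod 39)))).card = 1) ∧
    (Finset.univ.filter fun t : ZMod 39 => t.val.Coprime 39).card = 24 := by
  refine ⟨by decide, ⟨by decide, by decide, by decide, by decide, by decide, by decide, by decide⟩,
    ⟨by decide, by decide, by decide, by decide, by decide, by decide, by decide⟩, by decide⟩

open scoped Classical in
/-- **CENSUS ROW `(39, ℚ(√−3))` — YES, HYPOTHESIS-FREE**: for any CM type `Φ` of a cyclotomic CM field `K ⊇ ℚ(ζ₃₉)`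
balanced for `N_K = {t ≡ 2 (mod 3)}` (Weil signature `(6,6)` over `ℚ(√−3)`), if `n₊₋(Φ) := |S_Φ ∩ {14,17,23,29,35,38}|`
is ODD then `ℂ^Φ/Φ(ℤ[ζ₃₉])` CARRIES an `ι`-compatible principal polarisation (`λ₊ ≡ n₊₋ + 3`, `λ₋ ≡ (6 − n₊₋) + 5`).
With part 36's `…thirtyNine_of_even`: for `K`-balanced `Φ`, **principal ⟺ `n₊₋(Φ)` odd** — census b01.25 (A) at
`(39, ℚ(√−3))` in the kernel (472 YES / 452 NO; no PARI, no class field theory).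
research route conditional on HC_CM; not a corollary; Q11.4-sentence-2 already refuted in dim ≥ 3. [cite: Shimura1998, §14.3 Prop. 5, p. 104] -/
theorem exists_principal_thirtyNine_sqrt_neg_three [IsCMField K] [IsCyclotomicExtension {39} ℚ K]
    (hζ : IsPrimitiveRoot ζ 39) (Φ : CMType K)
    (hbal : 2 * ((Finset.univ.filter fun t : ZMod 39 => ∃ σ ∈ Φ.1, σ ζ = 𝐞 t) ∩
        ({2, 5, 8, 11, 14, 17, 20, 23, 29, 32, 35, 38} : Finset (ZMod 39))).card =
      (Finset.univ.filter fun t : ZMod 39 => ∃ σ ∈ Φ.1, σ ζ = 𝐞 t).card)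
    (hodd : Odd (((Finset.univ.filter fun t : ZMod 39 => ∃ σ ∈ Φ.1, σ ζ = 𝐞 t) ∩
      ({14, 17, 23, 29, 35, 38} : Finset (ZMod 39))).card)) :
    ∃ ζ' : K, IsCMField.complexConj K ζ' = -ζ' ∧ (∀ φ : Φ.1, 0 < (φ.1 ζ').im) ∧
        CMTypeLattice.IsOfType (1 : (FractionalIdeal (𝓞 K)⁰ K)ˣ) ζ' ⊤ := by
  classical
  obtain ⟨hNodd, ⟨hNK, hEp, hEm, hunion, hdisj, hdp, hdm⟩, -, hU⟩ := rowData_thirtyNine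
  obtain ⟨hcompl, -, hCm, hCp, -, -⟩ := classFacts_thirtyNine
  have hS := isCMTypeSet_residueFilter hζ Φ
  obtain ⟨h1, h2, h3⟩ := row_parities hS hNodd hNK hcompl hCp hCm hEp hEm hunion hdisj
  have hcard : (Finset.univ.filter fun t : ZMod 39 => ∃ σ ∈ Φ.1, σ ζ = 𝐞 t).card = 12 := by
    have := two_mul_card_eq_card_units hS; omega
  rw [hdp] at h1; rw [hdm] at h2
  rw [hcard] at hbal
  obtain ⟨j, hj⟩ := hodd
  refine exists_principal_thirtyNine_of_even_on hζ Φ ?_ ?_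
  · rw [Nat.even_iff]; omega
  · rw [Nat.even_iff]; omega

open scoped Classical in
/-- **CENSUS ROW `(39, ℚ(√−39))` — YES, HYPOTHESIS-FREE**: for any CM type `Φ` balanced for
`N_K = {7,14,17,19,23,28,29,31,34,35,37,38}` (the residues conjugating `√−39`), if `n₊₋(Φ) := |S_Φ ∩ {14,17,23,29,35,38}|`
is ODD then `ℂ^Φ/Φ(ℤ[ζ₃₉])` CARRIES an `ι`-compatible principal polarisation (`λ₊ ≡ n₊₋ + 3`,
`λ₋ ≡ (6 − n₊₋) + 1`).  With part 36: for `K`-balanced `Φ`, **principal ⟺ `n₊₋(Φ)` odd** — census b01.25 (A) at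
`(39, ℚ(√−39))` in the kernel (472 YES / 452 NO).
research route conditional on HC_CM; not a corollary; Q11.4-sentence-2 already refuted in dim ≥ 3. [cite: Shimura1998, §14.3 Prop. 5, p. 104] -/
theorem exists_principal_thirtyNine_sqrt_neg_thirtyNine [IsCMField K] [IsCyclotomicExtension {39} ℚ K]
    (hζ : IsPrimitiveRoot ζ 39) (Φ : CMType K)
    (hbal : 2 * ((Finset.univ.filter fun t : ZMod 39 => ∃ σ ∈ Φ.1, σ ζ = 𝐞 t) ∩
        ({7, 14, 17, 19, 23, 28, 29, 31, 34, 35, 37, 38} : Finset (ZMod 39))).card =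
      (Finset.univ.filter fun t : ZMod 39 => ∃ σ ∈ Φ.1, σ ζ = 𝐞 t).card)
    (hodd : Odd (((Finset.univ.filter fun t : ZMod 39 => ∃ σ ∈ Φ.1, σ ζ = 𝐞 t) ∩
      ({14, 17, 23, 29, 35, 38} : Finset (ZMod 39))).card)) :
    ∃ ζ' : K, IsCMField.complexConj K ζ' = -ζ' ∧ (∀ φ : Φ.1, 0 < (φ.1 ζ').im) ∧
        CMTypeLattice.IsOfType (1 : (FractionalIdeal (𝓞 K)⁰ K)ˣ) ζ' ⊤ := by
  classical
  obtain ⟨hNodd, -, ⟨hNK, hEp, hEm, hunion, hdisj, hdp, hdm⟩, hU⟩ := rowData_thirtyNine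
  obtain ⟨hcompl, -, hCm, hCp, -, -⟩ := classFacts_thirtyNine
  have hS := isCMTypeSet_residueFilter hζ Φ
  obtain ⟨h1, h2, h3⟩ := row_parities hS hNodd hNK hcompl hCp hCm hEp hEm hunion hdisj
  have hcard : (Finset.univ.filter fun t : ZMod 39 => ∃ σ ∈ Φ.1, σ ζ = 𝐞 t).card = 12 := by
    have := two_mul_card_eq_card_units hS; omega
  rw [hdp] at h1; rw [hdm] at h2
  rw [hcard] at hbal
  obtain ⟨j, hj⟩ := hodd
  refine exists_principal_thirtyNine_of_even_on hζ Φ ?_ ?_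
  · rw [Nat.even_iff]; omega
  · rw [Nat.even_iff]; omega

end Summit.HodgeConjecture.Ring2WeilCoverage.CyclotomicTwistedLevel39Yes

end
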